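/-
Copyright (c) 2026 the pub-hodgecm-mathlib formalisation cell (harness21).  Prover seat hodgecm-mathlib-K2Liu-p12 (g2): Track B «K2-LIT»,
#184♮ = hLiu418 = stmt-HodgeConjecture-24832; Road Φ of socket #41, organ Φ4-EXACT (LEAD F0P6-plan ruling «M-157p»), file E0.
-/
import Summits.HodgeConjecture.HodgeConjecture.Theorems.K2LiuSiegelWeylUnipotentContent   -- ★ U2: `adapt (matA (w_Δ n X)) = (0 1; 1 X)`, block integrality of `K_v`
import HarnessLib

/-!
# Crux `HLiu418`, Road Φ of socket #41, organ Φ4-EXACT — FILE E0: THE EXACT CONTENT OF `w_Δ n(X)` AT RANK TWO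

Cell `hodgecm-mathlib`, crux item hLiu418 = `stmt-HodgeConjecture-24832`, route of record `HCCMUnconditional`; squad K2 ∕ K2Liu, road `K2_Liu`,
socket #41 `sig_K2LiuSiegelEisensteinContinuation`, Road Φ, organ Φ4-EXACT «the unimodular good-place value» (ruling M-157p; method memo
`K2/K2Liu-p12/g2/CENSUS-PHI4-EXACT-Method.K2Liu-p12-g2.md` §1 (a)).  THEOREMS ONLY (no `def`, no `instance`, no `notation`, no named-fact hypothesis,
no `sorry`); lane `--supports stmt-HodgeConjecture-24832` (count-neutral helper; closes no socket by itself).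

THE STATEMENT.  ★ U2 proved the one-sided content bound `|det_Δ p|_w ≤ 1` for every Iwasawa factorisation `w_Δ n(X) = p k` (`p ∈ P_Δ(F_v)`,
`k ∈ K_v`).  Here, for `n = 2`, the content is computed EXACTLY, with no Smith form and no minors beyond `det`: at every `w ∣ v` with `|2|_w = 1`,
  **`|det_Δ p|_w · max(1, max_{ij} |X_ij|_w, |det X|_w) = 1`.**
* UPPER (general `n`, §1–§2): the adapted matrix of `k⁻¹ = (w_Δ n(X))⁻¹ p` is `(−X 1; 1 0)(A B; 0 D) = (−XA, D − XB; A, B)`, so `A := A(p)` and `XA` are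
  integral at `w`; hence `det A · X = (XA) · adj A` and `det A · det X = det(XA)` are integral: `|det A|_w |X_ij|_w ≤ 1`, `|det A|_w |det X|_w ≤ 1`.
* LOWER (`n = 2`, §1, §3): from `(0 1; 1 X) = (A B; 0 D)(k_A k_B; k_C k_D)` one reads `D k_C = 1`, `D k_D = X`, `B k_C = −A k_A`, whence
  `A · (k_B − k_A X) = 1`; with `k_A, k_B` integral, the `2 × 2` identity `det(P − RX) = det P − L(X) + det R · det X` (`L` linear) gives
  `|det A|_w⁻¹ = |det(k_B − k_A X)|_w ≤ max(1, ‖X‖_w, |det X|_w)`.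
Since `det_Δ p = det A(p)` (★ `detDelta_levi`), the two bounds pin the content.  §4 restates the result in the `Valued.v` letter of the ball files
(★ F3c-1): in the three «attained» forms `|det_Δ p|_w = 1` (unit ball), `|det_Δ p · X_{i₀j₀}|_w = 1` (an entry dominates), `|det_Δ p · det X|_w = 1`
(the determinant dominates) — the inputs of the content stratification of the unramified Whittaker coefficient (files E1–E5).

## References
* [Shimura1997] G. Shimura, *Euler Products and Eisenstein Series*, CBMS 93 (1997), §13.5–13.6 (the content ideal `ν₀(X)` of `(1 X; 0 1)`-cosets).
* [KudlaSweet1997] S. Kudla, W. J. Sweet, *Degenerate principal series representations for U(n,n)*, Israel J. Math. 98 (1997), §1.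
* [Casselman1980] W. Casselman, Compositio Math. 40 (1980), §3.   * [Kudla1994] S. S. Kudla, Israel J. Math. 87 (1994), §3 (`w_Δ`, `P_Δ`, adapted blocks).
-/

set_option autoImplicit false
-- the mandated namespace repeats the single-problem summit's segment (`HodgeConjecture.HodgeConjecture`)
set_option linter.dupNamespace false

noncomputable section

open scoped Matrix ValuativeRel
open NumberField IsDedekindDomain Matrix ValuativeRel
open Literature.NumberTheory.Automorphic Literature.NumberTheory.Automorphic.UnitaryGroup
open Literature.NumberTheory.GelbartRogawski1991.AdaptedBlocks
open Literature.NumberTheory.GelbartRogawski1991.UnitaryDualPair.LocalSplitting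
open Literature.NumberTheory.K2Lit.LocalSiegelDoubled
open Summit.HodgeConjecture.HodgeConjecture.Cruxes.HLiu418.K2LiuSiegelLeviWeylAlgebra
open Summit.HodgeConjecture.HodgeConjecture.Cruxes.HLiu418.K2LiuSiegelWeylUnipotentContent

namespace Summit.HodgeConjecture.HodgeConjecture.Cruxes.HLiu418.K2LiuHerm2ContentExact

/-! ## §1 Valuation algebra over a valued field: `det A · X = (XA) adj A`, and the `2 × 2` expansion of `det(P − RX)` -/

section Algebra

variable {K : Type*} [Field K] [ValuativeRel K] {m : Type*} [Fintype m] [DecidableEq m]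

omit [ValuativeRel K] in
/-- `det A · X = (X A) · adj A`. [folklore] -/
theorem det_smul_eq_mul_mul_adjugate (A X : Matrix m m K) : A.det • X = X * A * A.adjugate := by
  rw [Matrix.mul_assoc, Matrix.mul_adjugate, Matrix.mul_smul, Matrix.mul_one]

/-- **upper bound, entries**: `A` and `XA` integral ⇒ `|det A · X_ij| ≤ 1`. [cite: Shimura1997, §13.5] -/
theorem valuation_det_mul_apply_le_one {A X : Matrix m m K} (hA : ValBound 1 A) (hXA : ValBound 1 (X * A)) (i j : m) :
    valuation K (A.det * X i j) ≤ 1 := by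
  have h : ValBound (1 * 1) (X * A * A.adjugate) := hXA.mul (valBound_one_adjugate hA)
  rw [one_mul, ← det_smul_eq_mul_mul_adjugate] at h
  have hij := h i j
  rwa [Matrix.smul_apply, smul_eq_mul] at hij

/-- **upper bound, determinant**: `XA` integral ⇒ `|det A · det X| ≤ 1`. [cite: Shimura1997, §13.5] -/
theorem valuation_det_mul_det_le_one {A X : Matrix m m K} (hXA : ValBound 1 (X * A)) :
    valuation K (A.det * X.det) ≤ 1 := by
  rw [mul_comm, ← Matrix.det_mul]
  exact valuation_det_le_one hXA

omit [ValuativeRel K] in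
/-- the `2 × 2` identity `det(P − R X) = det P − L + det R · det X`, `L` linear in the entries of `R X`. [folklore] -/
theorem det_sub_mul_fin_two (P R X : Matrix (Fin 2) (Fin 2) K) :
    (P - R * X).det = P.det - (P 0 0 * (R * X) 1 1 + (R * X) 0 0 * P 1 1 - P 0 1 * (R * X) 1 0 - (R * X) 0 1 * P 1 0)
      + R.det * X.det := by
  simp only [Matrix.det_fin_two, Matrix.sub_apply, Matrix.mul_apply, Fin.sum_univ_two]
  ring

/-- **lower bound engine** (`2 × 2`): `P`, `R` integral, entries of `X` and `det X` of valuation `≤ γ`, `1 ≤ γ` ⇒ `|det(P − RX)| ≤ γ`.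
[cite: Shimura1997, §13.6] -/
theorem valuation_det_sub_mul_le {P R X : Matrix (Fin 2) (Fin 2) K} (hP : ValBound 1 P) (hR : ValBound 1 R)
    {γ : ValueGroupWithZero K} (hγ : 1 ≤ γ) (hX : ValBound γ X) (hXd : valuation K X.det ≤ γ) :
    valuation K (P - R * X).det ≤ γ := by
  have hRX : ValBound γ (R * X) := by
    have h := hR.mul hX
    rwa [one_mul] at h
  have hdP : valuation K P.det ≤ γ := (valuation_det_le_one hP).trans hγ
  have hdR : valuation K (R.det * X.det) ≤ γ := by
    rw [map_mul]
    calc valuation K R.det * valuation K X.det ≤ 1 * γ := mul_le_mul' (valuation_det_le_one hR) hXd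
      _ = γ := one_mul γ
  have h1 : ∀ a b : K, valuation K a ≤ 1 → valuation K b ≤ γ → valuation K (a * b) ≤ γ := fun a b ha hb => by
    rw [map_mul]
    calc valuation K a * valuation K b ≤ 1 * γ := mul_le_mul' ha hb
      _ = γ := one_mul γ
  have h2 : ∀ a b : K, valuation K a ≤ γ → valuation K b ≤ 1 → valuation K (a * b) ≤ γ := fun a b ha hb => by
    rw [map_mul]
    calc valuation K a * valuation K b ≤ γ * 1 := mul_le_mul' ha hb
      _ = γ := mul_one γ
  have hL : valuation K (P 0 0 * (R * X) 1 1 + (R * X) 0 0 * P 1 1 - P 0 1 * (R * X) 1 0 - (R * X) 0 1 * P 1 0) ≤ γ :=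
    Valuation.map_sub_le _ (Valuation.map_sub_le _ (Valuation.map_add_le _ (h1 _ _ (hP 0 0) (hRX 1 1)) (h2 _ _ (hRX 0 0) (hP 1 1)))
      (h1 _ _ (hP 0 1) (hRX 1 0))) (h2 _ _ (hRX 0 1) (hP 1 0))
  rw [det_sub_mul_fin_two]
  exact Valuation.map_add_le _ (Valuation.map_sub_le _ hdP hL) hdR

end Algebra

/-! ## §2 The adapted blocks of the Iwasawa factors of `w_Δ n(X) = p k` (general `n`) -/

section General

variable (F : Type) [Field F] [NumberField F] (E : Type) [Field E] [NumberField E] [Algebra F E]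
  [Algebra.IsQuadraticExtension F E] (c : E ≃ₐ[F] E) (v : HeightOneSpectrum (𝓞 F)) (n : ℕ) {T₀ : Matrix (Fin n) (Fin n) F}
  {JD : Matrix (Fin (n + n)) (Fin (n + n)) E} (hJD : JD = (gramD F n T₀).map (algebraMap F E))

include hJD in
omit [Algebra.IsQuadraticExtension F E] in
/-- the adapted matrix of `(w_Δ n(X))⁻¹` is `(−X 1; 1 0)`. [cite: Kudla1994, §3] -/
theorem adapt_matA_inv_weylDelta_mul_nElem (X : Matrix (Fin n) (Fin n) (LocalRing E v))
    (hX : (X.map (conjLocal E c v))ᵀ * gramS F E v n T₀ + gramS F E v n T₀ * X = 0) :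
    adapt (matA F E c v n (weylDelta F E c v n hJD * nElem F E c v n hJD X hX)⁻¹) = Matrix.fromBlocks (-X) 1 1 0 := by
  have h1 : adapt (matA F E c v n (weylDelta F E c v n hJD * nElem F E c v n hJD X hX)⁻¹) * Matrix.fromBlocks 0 1 1 X = 1 := by
    rw [← adapt_matA_weylDelta_mul_nElem F E c v n hJD X hX, ← adapt_mul, matA_mul, inv_mul_cancel, matA_one, adapt_one]
  have h2 : Matrix.fromBlocks (-X) 1 1 0 * Matrix.fromBlocks (0 : Matrix (Fin n) (Fin n) (LocalRing E v)) 1 1 X = 1 := by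
    rw [Matrix.fromBlocks_multiply, ← Matrix.fromBlocks_one]
    simp only [Matrix.mul_zero, Matrix.one_mul, zero_add, Matrix.mul_one, neg_add_cancel, Matrix.zero_mul, add_zero]
  rw [← Matrix.inv_eq_left_inv h1, Matrix.inv_eq_left_inv h2]

include hJD in
omit [Algebra.IsQuadraticExtension F E] in
/-- **the blocks of `k⁻¹`**: for `w_Δ n(X) = p k` with `C(p) = 0`, `C(k⁻¹) = A(p)` and `A(k⁻¹) = −X A(p)`. [cite: Kudla1994, §3] [cite: Shimura1997, §13.5] -/
theorem blkC_blkA_inv_of_factor (X : Matrix (Fin n) (Fin n) (LocalRing E v))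
    (hX : (X.map (conjLocal E c v))ᵀ * gramS F E v n T₀ + gramS F E v n T₀ * X = 0)
    {p k : UnitaryGroup.localPi E c (n + n) JD v} (hC : blkC (matA F E c v n p) = 0)
    (hg : weylDelta F E c v n hJD * nElem F E c v n hJD X hX = p * k) :
    blkC (matA F E c v n k⁻¹) = blkA (matA F E c v n p) ∧ blkA (matA F E c v n k⁻¹) = -(X * blkA (matA F E c v n p)) := by
  have hk : (weylDelta F E c v n hJD * nElem F E c v n hJD X hX)⁻¹ * p = k⁻¹ := by
    rw [hg, _root_.mul_inv_rev, inv_mul_cancel_right]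
  have h := congrArg adapt (matA_mul F E c v n (weylDelta F E c v n hJD * nElem F E c v n hJD X hX)⁻¹ p)
  rw [adapt_mul, adapt_matA_inv_weylDelta_mul_nElem F E c v n hJD X hX, adapt_eq (matA F E c v n p), hC, Matrix.fromBlocks_multiply, hk,
    adapt_eq (matA F E c v n k⁻¹)] at h
  obtain ⟨h11, -, h21, -⟩ := Matrix.fromBlocks_inj.1 h
  simp only [Matrix.mul_zero, add_zero, Matrix.one_mul, Matrix.neg_mul] at h11 h21
  exact ⟨h21.symm, h11.symm⟩

include hJD in
omit [Algebra.IsQuadraticExtension F E] in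
/-- **the inverse of `A(p)` in terms of the blocks of `k`**: for `w_Δ n(X) = p k` with `C(p) = 0`, `A(p) · (B(k) − A(k) X) = 1`
(`D k_C = 1`, `D k_D = X`, `B k_C = −A k_A`, `A k_B + B k_D = 1`). [cite: Kudla1994, §3] [cite: Shimura1997, §13.6] -/
theorem blkA_mul_sub_eq_one (X : Matrix (Fin n) (Fin n) (LocalRing E v))
    (hX : (X.map (conjLocal E c v))ᵀ * gramS F E v n T₀ + gramS F E v n T₀ * X = 0)
    {p k : UnitaryGroup.localPi E c (n + n) JD v} (hC : blkC (matA F E c v n p) = 0)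
    (hg : weylDelta F E c v n hJD * nElem F E c v n hJD X hX = p * k) :
    blkA (matA F E c v n p) * (blkB (matA F E c v n k) - blkA (matA F E c v n k) * X) = 1 := by
  have h := adapt_matA_weylDelta_mul_nElem F E c v n hJD X hX
  rw [hg, ← matA_mul, adapt_mul, adapt_eq (matA F E c v n p), adapt_eq (matA F E c v n k), hC, Matrix.fromBlocks_multiply] at h
  obtain ⟨h11, h12, h21, h22⟩ := Matrix.fromBlocks_inj.1 h
  simp only [Matrix.zero_mul, zero_add] at h21 h22
  -- names
  set A := blkA (matA F E c v n p)
  set B := blkB (matA F E c v n p)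
  set D := blkD (matA F E c v n p)
  set kA := blkA (matA F E c v n k)
  set kB := blkB (matA F E c v n k)
  set kC := blkC (matA F E c v n k)
  set kD := blkD (matA F E c v n k)
  have h21' : kC * D = 1 := mul_eq_one_comm.1 h21
  have hBkC : B * kC = -(A * kA) := eq_neg_of_add_eq_zero_right h11
  have hB : B = -(A * kA) * D := by
    calc B = B * (kC * D) := by rw [h21', Matrix.mul_one]
      _ = B * kC * D := (Matrix.mul_assoc _ _ _).symm
      _ = -(A * kA) * D := by rw [hBkC]
  have hAkB : A * kB = 1 - B * kD := eq_sub_of_add_eq h12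
  calc A * (kB - kA * X) = A * kB - A * kA * X := by rw [Matrix.mul_sub, Matrix.mul_assoc]
    _ = 1 - B * kD - A * kA * X := by rw [hAkB]
    _ = 1 := by rw [hB, Matrix.neg_mul, Matrix.neg_mul, Matrix.mul_assoc, h22, sub_neg_eq_add, add_sub_cancel_right]

end General

/-! ## §3 The exact content at a place `w ∣ v` (`n = 2`) -/

section RankTwo

variable (F : Type) [Field F] [NumberField F] (E : Type) [Field E] [NumberField E] [Algebra F E]
  [Algebra.IsQuadraticExtension F E] (c : E ≃ₐ[F] E) {δ : E} (hcδ : c δ = -δ) (hδ : δ ≠ 0) {dd : F} (hd : δ * δ = algebraMap F E dd)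
  (v : HeightOneSpectrum (𝓞 F)) {T₀ : Matrix (Fin 2) (Fin 2) F} (hT₀ : T₀.IsSymm)
  {JD : Matrix (Fin (2 + 2)) (Fin (2 + 2)) E} (hJD : JD = (gramD F 2 T₀).map (algebraMap F E))

include hcδ hδ hd hT₀ hJD in
/-- **THE EXACT CONTENT, valuation form.**  Let `w_Δ n(X) = p k` with `p ∈ P_Δ(F_v)`, `k ∈ K_v`, and let `w ∣ v` with `|2|_w = 1`.  Then
(o) `|det_Δ p|_w ≤ 1`; (i) `|det_Δ p · X_ij|_w ≤ 1` for all `i j`; (ii) `|det_Δ p · det X|_w ≤ 1`; (iii) for every `γ ≥ 1` bounding the `|X_ij|_w`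
and `|det X|_w`: `1 ≤ |det_Δ p|_w · γ`.  So `|det_Δ p|_w = max(1, max_ij |X_ij|_w, |det X|_w)⁻¹` — the content of `X` at `w`.
[cite: Shimura1997, §13.5–13.6] [cite: KudlaSweet1997, §1] [cite: Casselman1980, §3] -/
theorem valuation_detDelta_content
    (X : Matrix (Fin 2) (Fin 2) (LocalRing E v)) (hX : (X.map (conjLocal E c v))ᵀ * gramS F E v 2 T₀ + gramS F E v 2 T₀ * X = 0)
    {p k : UnitaryGroup.localPi E c (2 + 2) JD v} (hp : IsSiegelDelta F E c hcδ hδ hd v 2 hT₀ hJD p)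
    (hk : k ∈ UnitaryGroup.localInt E c (2 + 2) JD v) (hg : weylDelta F E c v 2 hJD * nElem F E c v 2 hJD X hX = p * k)
    (w : PlacesOver E v) (h2 : valuation (w.1.adicCompletion E) (2 : w.1.adicCompletion E) = 1) :
    valuation (w.1.adicCompletion E) (detDelta F E c v 2 w p) ≤ 1 ∧
      (∀ i j, valuation (w.1.adicCompletion E) (detDelta F E c v 2 w p * X i j w) ≤ 1) ∧
      valuation (w.1.adicCompletion E) (detDelta F E c v 2 w p * X.det w) ≤ 1 ∧
      ∀ γ : ValueGroupWithZero (w.1.adicCompletion E), 1 ≤ γ → (∀ i j, valuation (w.1.adicCompletion E) (X i j w) ≤ γ) →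
        valuation (w.1.adicCompletion E) (X.det w) ≤ γ → 1 ≤ valuation (w.1.adicCompletion E) (detDelta F E c v 2 w p) * γ := by
  -- abbreviations: the `w`-components
  set ev := Pi.evalRingHom (fun w' : PlacesOver E v => w'.1.adicCompletion E) w with hev
  have hC : blkC (matA F E c v 2 p) = 0 := (isSiegelDelta_iff_blkC_eq_zero F E c hcδ hδ hd v 2 hT₀ hJD p).1 hp
  -- `det_Δ p = det A_w`, `A := A(p)`
  have hdet : detDelta F E c v 2 w p = ((blkA (matA F E c v 2 p)).map ev).det := by
    rw [detDelta_levi F E c v 2 hC w, ← RingHom.mapMatrix_apply, ← RingHom.map_det]; rfl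
  have hXw : ∀ i j, X i j w = (X.map ev) i j := fun i j => rfl
  have hXd : X.det w = (X.map ev).det := by rw [← RingHom.mapMatrix_apply, ← RingHom.map_det]; rfl
  -- `A` and `XA` are integral at `w` (blocks of `k⁻¹ ∈ K_v`)
  obtain ⟨hkC, hkA⟩ := blkC_blkA_inv_of_factor F E c v 2 hJD X hX hC hg
  obtain ⟨hiA', -, hiC', -⟩ := isIntegralAt_blocks F E v 2 w h2 (isIntegralAt_matA_of_mem_localInt' F E c v 2 (Subgroup.inv_mem _ hk) w)
  have hAint : ValBound 1 ((blkA (matA F E c v 2 p)).map ev) := by rw [← hkC]; exact hiC'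
  have hXAint : ValBound 1 (X.map ev * (blkA (matA F E c v 2 p)).map ev) := by
    have h : IsIntegralAt F E v w (X * blkA (matA F E c v 2 p)) := by
      have h' := IsIntegralAt.neg hiA'
      rwa [hkA, neg_neg] at h'
    rw [← Matrix.map_mul]; exact h
  -- `k_A`, `k_B` integral at `w`
  obtain ⟨hikA, hikB, -, -⟩ := isIntegralAt_blocks F E v 2 w h2 (isIntegralAt_matA_of_mem_localInt' F E c v 2 hk w)
  refine ⟨?_, fun i j => ?_, ?_, fun γ hγ hXγ hdγ => ?_⟩
  · rw [hdet]; exact valuation_det_le_one hAint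
  · rw [hdet, hXw]; exact valuation_det_mul_apply_le_one hAint hXAint i j
  · rw [hdet, hXd]; exact valuation_det_mul_det_le_one hXAint
  · -- `A (k_B − k_A X) = 1` at `w`
    have h1 := congrArg (fun M : Matrix (Fin 2) (Fin 2) (LocalRing E v) => (M.map ev).det) (blkA_mul_sub_eq_one F E c v 2 hJD X hX hC hg)
    simp only [Matrix.map_mul, Matrix.map_sub ev (map_sub ev), Matrix.map_one ev (map_zero ev) (map_one ev), Matrix.det_mul,
      Matrix.det_one] at h1
    have hle : valuation (w.1.adicCompletion E) ((blkB (matA F E c v 2 k)).map ev - (blkA (matA F E c v 2 k)).map ev * X.map ev).det ≤ γ :=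
      valuation_det_sub_mul_le hikB hikA hγ (fun i j => hXγ i j) (by rw [← hXd]; exact hdγ)
    calc (1 : ValueGroupWithZero (w.1.adicCompletion E))
        = valuation (w.1.adicCompletion E) (((blkA (matA F E c v 2 p)).map ev).det *
            ((blkB (matA F E c v 2 k)).map ev - (blkA (matA F E c v 2 k)).map ev * X.map ev).det) := by rw [h1, map_one]
      _ = valuation (w.1.adicCompletion E) ((blkA (matA F E c v 2 p)).map ev).det *
            valuation (w.1.adicCompletion E) ((blkB (matA F E c v 2 k)).map ev - (blkA (matA F E c v 2 k)).map ev * X.map ev).det :=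
          map_mul _ _ _
      _ ≤ valuation (w.1.adicCompletion E) (detDelta F E c v 2 w p) * γ := by rw [hdet]; exact mul_le_mul' le_rfl hle

/-! ## §4 The three attained forms, in the `Valued.v` letter of the ball files -/

include hcδ hδ hd hT₀ hJD in
/-- **unit ball**: `X` integral at `w` (entries and determinant) ⇒ `|det_Δ p|_w = 1`. [cite: Shimura1997, §13.6] [cite: Casselman1980, §3] -/
theorem v_detDelta_eq_one_of_integral
    (X : Matrix (Fin 2) (Fin 2) (LocalRing E v)) (hX : (X.map (conjLocal E c v))ᵀ * gramS F E v 2 T₀ + gramS F E v 2 T₀ * X = 0)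
    {p k : UnitaryGroup.localPi E c (2 + 2) JD v} (hp : IsSiegelDelta F E c hcδ hδ hd v 2 hT₀ hJD p)
    (hk : k ∈ UnitaryGroup.localInt E c (2 + 2) JD v) (hg : weylDelta F E c v 2 hJD * nElem F E c v 2 hJD X hX = p * k)
    (w : PlacesOver E v) (h2 : valuation (w.1.adicCompletion E) (2 : w.1.adicCompletion E) = 1)
    (hX1 : ∀ i j, Valued.v (X i j w) ≤ 1) (hXd : Valued.v (X.det w) ≤ 1) :
    Valued.v (detDelta F E c v 2 w p) = 1 := by
  obtain ⟨hU, -, -, hL⟩ := valuation_detDelta_content F E c hcδ hδ hd v hT₀ hJD X hX hp hk hg w h2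
  rw [v_eq_one_iff_valuation_eq_one]
  refine le_antisymm hU ?_
  have h := hL 1 le_rfl (fun i j => (v_le_one_iff_valuation_le_one _).1 (hX1 i j)) ((v_le_one_iff_valuation_le_one _).1 hXd)
  rwa [mul_one] at h

include hcδ hδ hd hT₀ hJD in
/-- **an entry dominates**: if `|X_{i₀j₀}|_w ≥ 1` bounds all `|X_ij|_w` and `|det X|_w`, then `|det_Δ p · X_{i₀j₀}|_w = 1`.
[cite: Shimura1997, §13.6] [cite: KudlaSweet1997, §1] -/
theorem v_detDelta_mul_apply_eq_one
    (X : Matrix (Fin 2) (Fin 2) (LocalRing E v)) (hX : (X.map (conjLocal E c v))ᵀ * gramS F E v 2 T₀ + gramS F E v 2 T₀ * X = 0)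
    {p k : UnitaryGroup.localPi E c (2 + 2) JD v} (hp : IsSiegelDelta F E c hcδ hδ hd v 2 hT₀ hJD p)
    (hk : k ∈ UnitaryGroup.localInt E c (2 + 2) JD v) (hg : weylDelta F E c v 2 hJD * nElem F E c v 2 hJD X hX = p * k)
    (w : PlacesOver E v) (h2 : valuation (w.1.adicCompletion E) (2 : w.1.adicCompletion E) = 1)
    (i₀ j₀ : Fin 2) (h1 : 1 ≤ Valued.v (X i₀ j₀ w)) (hmax : ∀ i j, Valued.v (X i j w) ≤ Valued.v (X i₀ j₀ w))
    (hdet : Valued.v (X.det w) ≤ Valued.v (X i₀ j₀ w)) :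
    Valued.v (detDelta F E c v 2 w p * X i₀ j₀ w) = 1 := by
  obtain ⟨-, hU, -, hL⟩ := valuation_detDelta_content F E c hcδ hδ hd v hT₀ hJD X hX hp hk hg w h2
  rw [v_eq_one_iff_valuation_eq_one]
  refine le_antisymm (hU i₀ j₀) ?_
  have h1' : (1 : ValueGroupWithZero (w.1.adicCompletion E)) ≤ valuation (w.1.adicCompletion E) (X i₀ j₀ w) := by
    rw [← map_one (valuation (w.1.adicCompletion E)), ← v_le_iff_valuation_le, map_one]; exact h1
  have h := hL _ h1' (fun i j => (v_le_iff_valuation_le _ _).1 (hmax i j)) ((v_le_iff_valuation_le _ _).1 hdet)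
  rwa [← map_mul] at h

include hcδ hδ hd hT₀ hJD in
/-- **the determinant dominates**: if `|det X|_w ≥ 1` bounds all `|X_ij|_w`, then `|det_Δ p · det X|_w = 1`.
[cite: Shimura1997, §13.6] [cite: KudlaSweet1997, §1] -/
theorem v_detDelta_mul_det_eq_one
    (X : Matrix (Fin 2) (Fin 2) (LocalRing E v)) (hX : (X.map (conjLocal E c v))ᵀ * gramS F E v 2 T₀ + gramS F E v 2 T₀ * X = 0)
    {p k : UnitaryGroup.localPi E c (2 + 2) JD v} (hp : IsSiegelDelta F E c hcδ hδ hd v 2 hT₀ hJD p)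
    (hk : k ∈ UnitaryGroup.localInt E c (2 + 2) JD v) (hg : weylDelta F E c v 2 hJD * nElem F E c v 2 hJD X hX = p * k)
    (w : PlacesOver E v) (h2 : valuation (w.1.adicCompletion E) (2 : w.1.adicCompletion E) = 1)
    (h1 : 1 ≤ Valued.v (X.det w)) (hmax : ∀ i j, Valued.v (X i j w) ≤ Valued.v (X.det w)) :
    Valued.v (detDelta F E c v 2 w p * X.det w) = 1 := by
  obtain ⟨-, -, hU, hL⟩ := valuation_detDelta_content F E c hcδ hδ hd v hT₀ hJD X hX hp hk hg w h2
  rw [v_eq_one_iff_valuation_eq_one]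
  refine le_antisymm hU ?_
  have h1' : (1 : ValueGroupWithZero (w.1.adicCompletion E)) ≤ valuation (w.1.adicCompletion E) (X.det w) := by
    rw [← map_one (valuation (w.1.adicCompletion E)), ← v_le_iff_valuation_le, map_one]; exact h1
  have h := hL _ h1' (fun i j => (v_le_iff_valuation_le _ _).1 (hmax i j)) le_rfl
  rwa [← map_mul] at h

end RankTwo

end Summit.HodgeConjecture.HodgeConjecture.Cruxes.HLiu418.K2LiuHerm2ContentExact

end
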